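import Summits.BirchSwinnertonDyer.BirchSwinnertonDyer.Theses.PrintCf2
import Summits.BirchSwinnertonDyer.Rank1Residual.P2.ShuZhaiOneFortyFourSlices
import Summits.BirchSwinnertonDyer.Rank1Residual.WAll.TargetCMTwoInertShuZhaiOneFortyFour
import Summits.BirchSwinnertonDyer.Rank1Residual.P2.KrizLiTwoFortyThreeGoodAtTwo
import HarnessLib

/-!
# Route PrintCf2 — the W-ALL leaf `WAllCornerFTwoInertShuZhaiOneFortyFour` CLOSED granted the named facts,
# and the inert residual of crux `InertJZeroOfFacts` (stmt-BirchSwinnertonDyer-20671) re-cut EXACTLY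
# (helper `--supports stmt-BirchSwinnertonDyer-20671`; cell `bsd-print-cf2`, D-0131 (2) PRINT TIER, seat p4)

HONEST FRAMING (cell `bsd-print-cf2`; the partition leaf `Summit.BirchSwinnertonDyer.WAllCornerFTwo` is OPEN AS A
CLASS). This file books, BY NAME, the SECOND `j = 0` Shu–Zhai family (base `144a1 : y² = x³ − 1`, members
`144a1^{(−pM)} ≅ y² = x³ + (pM)³`, `p ≡ 23 (mod 24)` prime, `M = ∏Q`, `q ≡ 5 (mod 12)`, `M ≡ 1 (mod 24)`; lit g4
DOSSIER §17) on the W-ALL side: §1 the leaf `WAllCornerFTwoInertShuZhaiOneFortyFour` (`WAll/TargetCMTwoInertShuZhaiOneFortyFour.lean`)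
holds granted Cassels, Shu–Zhai Thm 1.2 / 1.4, row C8 (Burungale–Flach), modularity, ARS06 Thm 2.6 and the
TABLE-COMPOSITE base fact `ShuZhai2021.base144a1_optimal_cuspZero` — seat p4's `P2.cornerFTwo_shuZhaiOneFortyFour_item`
(`P2/ShuZhaiOneFortyFourSlices.lean`) read on the leaf; equivalently from the antecedent 𝔅_inert⁺ of route
`PrintCf2` aside `InertShuZhaiOneFortyFourOfFactsPlus` (stmt-BirchSwinnertonDyer-21260, closed by
`Theorems/PrintCf2InertShuZhaiOneFortyFourOfFactsPlus.lean`); §2 after the three family leaves (SZ36 = aside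
20597, KL243 = aside 20766, SZ144 = aside 21260) the two inert slices of row 12₂ ARE the residual
`WAllCornerFTwoInertOffShuZhaiOffKrizLiOffShuZhaiOneFortyFour` (OPEN; no print: cube sums off the class of `9`,
the other Mordell curves, `27a4` / `j = 54000` twists, the five odd Heegner fields) — the named residual of the
inert `j = 0` / odd-Heegner roads, v3; §3 crux 20671 `InertJZeroOfFacts` (`j = 0`) and its two REGISTERED
stubs (`stub_inertJZero_goodAtTwo` / `stub_inertJZero_badAtTwo`, cut by reduction at `2`) after everything in
print, EXACT: the printed families sit in definite cells (SZ36, SZ144 BAD at `2` — the `36a1` isogeny-class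
version `not_good_two_of_isIsogenousToShuZhaiThirtySixTwist` is proved here —, KL243 GOOD at `2`), so granted
the table facts `stub_good ⟺ «off KL243»`, `stub_bad ⟺ «off SZ36 ∪ SZ144»`, and
`inertJZeroOfFacts_iff_cellResiduals_of_facts : InertJZeroOfFacts ⟺ (good cell off KL243) ∧ (bad cell off both
Shu–Zhai classes)` — THE NAMED RESIDUAL OF CRUX 20671 IN THE KERNEL. Nothing new is asserted; beyond-print
theorem: NO.
[cite: ShuZhai2021, Thm. 1.2 and Thm. 1.4] [cite: Cremona1997, Table 1 (N = 144, curve A1) and Table 4 (row 144 A)]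
[cite: AgasheRibetStein2006, Thm. 2.6] [cite: BurungaleFlach2024, Cor. 2] [cite: MilneADT2006, Thm. I.7.3]
[cite: Miller2011LMS, Def. 1.1]
-/

-- single-conjunct summit: `Summit.BirchSwinnertonDyer.BirchSwinnertonDyer.…` repeats the name by design
set_option linter.dupNamespace false

open WeierstrassCurve Literature.NumberTheory.EllipticCurves Literature.NumberTheory.EllipticCurves.Rank1Residual
  Literature.NumberTheory.EllipticCurves.ShuZhai2021 Literature.NumberTheory.EllipticCurves.KrizLi2019

namespace Summit.BirchSwinnertonDyer.PrintCf2

/-! ## §1 The leaf CLOSED granted the named facts -/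

/-- **`WAllCornerFTwoInertShuZhaiOneFortyFour` holds granted, BY NAME: Cassels' isogeny invariance (`hCassels`),
Shu–Zhai 2021 Thm 1.2 (`h12`) and Thm 1.4 (`h14`), the CM rank-zero row C8 (`hCM`, Burungale–Flach 2024 / Rubin),
modularity (`hmod`), Agashe–Ribet–Stein 2006 Thm 2.6 (`hARS`) and the base fact `base144a1_optimal_cuspZero`
(`hbase`)** — `P2.cornerFTwo_shuZhaiOneFortyFour_item` read on the leaf (the leaf is the item's consequent with
the predicate folded, `wAllCornerFTwoInertShuZhaiOneFortyFour_iff_item`). beyond-print: NO.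
[cite: ShuZhai2021, Thm. 1.2 and Thm. 1.4] [cite: Cremona1997, Table 1 (N = 144, curve A1) and Table 4 (row 144 A)]
[cite: MilneADT2006, Thm. I.7.3] [cite: AgasheRibetStein2006, Thm. 2.6] [cite: BurungaleFlach2024, Cor. 2]
[cite: Miller2011LMS, Def. 1.1] -/
theorem wAllCornerFTwoInertShuZhaiOneFortyFour_of_facts (hCassels : bsdRHS_eq_of_isIsogenous)
    (h12 : thm12_ranks_of_twists) (h14 : thm14_twoPartBSD_of_twists)
    (hCM : bsdTriple_of_hasCM_of_L_one_ne_zero) (hmod : hasEntireLFunction_rat)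
    (hARS : AgasheRibetStein2006.cremona_abs_maninConstant_eq_one_of_level_le)
    (hbase : base144a1_optimal_cuspZero) : WAllCornerFTwoInertShuZhaiOneFortyFour :=
  wAllCornerFTwoInertShuZhaiOneFortyFour_iff_item.2
    (Rank1Residual.P2.cornerFTwo_shuZhaiOneFortyFour_item hCassels h12 h14 hCM hmod hARS hbase)

/-- **The leaf from the antecedent 𝔅_inert⁺ of aside 21260** (𝔅_inert VERBATIM ∧ ARS06 ∧ the base fact): the
bundle-shaped closer (conjuncts used: (2) modularity, (3) Cassels, (4) row C8, (6) Thm 1.2, (7) Thm 1.4; ARS06;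
the base fact). [cite: ShuZhai2021, Thm. 1.2 and Thm. 1.4] [cite: Cremona1997, Table 1 (N = 144, A1) and Table 4 (144 A)] -/
theorem wAllCornerFTwoInertShuZhaiOneFortyFour_of_bundlePlus
    (h : (rank_eq_analyticRank_of_analyticRank_le_one ∧ WeierstrassCurve.hasEntireLFunction_rat ∧
        WeierstrassCurve.bsdRHS_eq_of_isIsogenous ∧ bsdTriple_of_hasCM_of_L_one_ne_zero ∧ thm112_bsdTwo_twist ∧
        thm12_ranks_of_twists ∧ thm14_twoPartBSD_of_twists ∧ thm410_twoAdicValuations_of_twists) ∧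
      AgasheRibetStein2006.cremona_abs_maninConstant_eq_one_of_level_le ∧ base144a1_optimal_cuspZero) :
    WAllCornerFTwoInertShuZhaiOneFortyFour := by
  obtain ⟨⟨_, hmod, hCas, hCM, _, h12, h14, _⟩, hARS, hbase⟩ := h
  exact wAllCornerFTwoInertShuZhaiOneFortyFour_of_facts hCas h12 h14 hCM hmod hARS hbase

/-- **The aside and the leaf say the same thing**: route item `InertShuZhaiOneFortyFourOfFactsPlus` is
`𝔅_inert⁺ → WAllCornerFTwoInertShuZhaiOneFortyFour` up to unfolding the membership predicate (`Iff.rfl`-level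
bridge for the planner: a LEAF-form twin of the aside would be defeq to the filed predicate form). [folklore] -/
theorem inertShuZhaiOneFortyFourOfFactsPlus_iff_leaf :
    Summit.BirchSwinnertonDyer.BirchSwinnertonDyer.Theses.PrintCf2.InertShuZhaiOneFortyFourOfFactsPlus ↔
      ((rank_eq_analyticRank_of_analyticRank_le_one ∧ WeierstrassCurve.hasEntireLFunction_rat ∧
        WeierstrassCurve.bsdRHS_eq_of_isIsogenous ∧ bsdTriple_of_hasCM_of_L_one_ne_zero ∧ thm112_bsdTwo_twist ∧
        thm12_ranks_of_twists ∧ thm14_twoPartBSD_of_twists ∧ thm410_twoAdicValuations_of_twists) ∧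
      AgasheRibetStein2006.cremona_abs_maninConstant_eq_one_of_level_le ∧ base144a1_optimal_cuspZero →
        WAllCornerFTwoInertShuZhaiOneFortyFour) :=
  Iff.rfl

/-! ## §2 The inert residual of crux 20671 / 20672 after the THREE printed families (EXACT) -/

/-- **Granted the named facts of all three families, the two inert slices of row 12₂ ARE the OFF³ residual**
`WAllCornerFTwoInertOffShuZhaiOffKrizLiOffShuZhaiOneFortyFour` (binders: the Shu–Zhai side `hCassels h12 h14 hCM hmod
hARS` with BOTH base facts `htab36` (§5.2 Table row 36a1) and `hbase144`; the Kriz–Li side `hKL h33 htab243 hS31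
hGZK`). [cite: ShuZhai2021, Thm. 1.2, Thm. 1.4, §5.2 Table row 36a1] [cite: KrizLi2019, Thm. 5.1 (2), Thm. 4.3 and §6 Table 1 row 243a1]
[cite: Cremona1997, Table 1 (N = 144, A1) and Table 4 (144 A)] [cite: CreutzMiller2012, Thm. 1.1] -/
theorem wAllCornerFTwoInert_iff_off3_of_facts (hCassels : bsdRHS_eq_of_isIsogenous)
    (h12 : thm12_ranks_of_twists) (h14 : thm14_twoPartBSD_of_twists)
    (hCM : bsdTriple_of_hasCM_of_L_one_ne_zero) (hmod : hasEntireLFunction_rat)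
    (hARS : AgasheRibetStein2006.cremona_abs_maninConstant_eq_one_of_level_le) (htab36 : table52_row36a1)
    (hbase144 : base144a1_optimal_cuspZero)
    (hKL : thm112_bsdTwo_twist) (h33 : thm33_rank_twist) (htab243 : table1_row243a1)
    (hS31 : bsdTriple_of_analyticRank_le_one_of_conductor_lt)
    (hGZK : rank_eq_analyticRank_of_analyticRank_le_one) :
    (WAllCornerFTwoInertGood ∧ WAllCornerFTwoInertBad) ↔
      WAllCornerFTwoInertOffShuZhaiOffKrizLiOffShuZhaiOneFortyFour :=
  wAllCornerFTwoInert_iff_off3_of_leaves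
    (wAllCornerFTwoInertShuZhaiThirtySix_of_facts hCassels h12 h14 hCM hmod hARS htab36)
    (wAllCornerFTwoInertKrizLiTwoFortyThree_of_facts hKL h33 htab243 hS31 hCM hmod hGZK hCassels)
    (wAllCornerFTwoInertShuZhaiOneFortyFour_of_facts hCassels h12 h14 hCM hmod hARS hbase144)

/-- **Crux 20363's consequent (= the two inert slices, granted its bundle 𝔅_inert) reduces to the OFF³ residual
plus the three base/table facts**: from 𝔅_inert, ARS06, the `36a1` table row, the `144a1` base fact, Kriz–Li
Thm 4.3, the Table-1 row `243a1` and Creutz–Miller S31, the inert slices hold iff the OFF³ residual holds — the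
named residual of the inert roads after everything in print (DOSSIER §15–§17). [folklore] -/
theorem inertSlices_iff_off3_of_bundle
    (hB : rank_eq_analyticRank_of_analyticRank_le_one ∧ WeierstrassCurve.hasEntireLFunction_rat ∧
        WeierstrassCurve.bsdRHS_eq_of_isIsogenous ∧ bsdTriple_of_hasCM_of_L_one_ne_zero ∧ thm112_bsdTwo_twist ∧
        thm12_ranks_of_twists ∧ thm14_twoPartBSD_of_twists ∧ thm410_twoAdicValuations_of_twists)
    (hARS : AgasheRibetStein2006.cremona_abs_maninConstant_eq_one_of_level_le) (htab36 : table52_row36a1)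
    (hbase144 : base144a1_optimal_cuspZero) (h33 : thm33_rank_twist) (htab243 : table1_row243a1)
    (hS31 : bsdTriple_of_analyticRank_le_one_of_conductor_lt) :
    (WAllCornerFTwoInertGood ∧ WAllCornerFTwoInertBad) ↔
      WAllCornerFTwoInertOffShuZhaiOffKrizLiOffShuZhaiOneFortyFour := by
  obtain ⟨hGZK, hmod, hCas, hCM, hKL, h12, h14, _⟩ := hB
  exact wAllCornerFTwoInert_iff_off3_of_facts hCas h12 h14 hCM hmod hARS htab36 hbase144 hKL h33 htab243 hS31 hGZK

/-! ## §3 Crux 20671 `InertJZeroOfFacts` (`j = 0`) and its two REGISTERED stubs after everything in print — EXACT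

The birth skeleton of crux 20671 (planner g2, sha 88db1a12…) cuts `j = 0` by reduction at `2`:
`stub_inertJZero_goodAtTwo` / `stub_inertJZero_badAtTwo` (`𝔅_inert → ∀ W, r_an = 1 → j = 0 → Good W 2 → BSDp W 2`,
resp. `¬ Good W 2`). The three printed families sit in DEFINITE cells: SZ36 and SZ144 are BAD at `2` (placement,
unconditional), KL243 is GOOD at `2` (p3's `good_two_of_isIsogenousToKrizLiTwoFortyThreeTwist`). So, granted the
table facts, each stub is EXACTLY its print-free residual: GOOD ⟺ «off the Kriz–Li `243a1` classes», BAD ⟺ «off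
both Shu–Zhai classes»; and the crux itself ⟺ the conjunction of the two residuals. -/

/-- **Crux 20671 splits EXACTLY into its two registered stubs** (excluded middle on `Good W 2`; pure logic).
[folklore] -/
theorem inertJZeroOfFacts_iff_stubs :
    Summit.BirchSwinnertonDyer.BirchSwinnertonDyer.Theses.PrintCf2.InertJZeroOfFacts ↔
      ((rank_eq_analyticRank_of_analyticRank_le_one ∧ hasEntireLFunction_rat ∧
        bsdRHS_eq_of_isIsogenous ∧ bsdTriple_of_hasCM_of_L_one_ne_zero ∧ thm112_bsdTwo_twist ∧
        thm12_ranks_of_twists ∧ thm14_twoPartBSD_of_twists ∧ thm410_twoAdicValuations_of_twists) →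
        ∀ (W : WeierstrassCurve ℚ) [W.IsElliptic] [W.IsGloballyMinimal], W.analyticRank = 1 → W.j = 0 →
          Good W 2 → BSDp W 2) ∧
      ((rank_eq_analyticRank_of_analyticRank_le_one ∧ hasEntireLFunction_rat ∧
        bsdRHS_eq_of_isIsogenous ∧ bsdTriple_of_hasCM_of_L_one_ne_zero ∧ thm112_bsdTwo_twist ∧
        thm12_ranks_of_twists ∧ thm14_twoPartBSD_of_twists ∧ thm410_twoAdicValuations_of_twists) →
        ∀ (W : WeierstrassCurve ℚ) [W.IsElliptic] [W.IsGloballyMinimal], W.analyticRank = 1 → W.j = 0 →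
          ¬ Good W 2 → BSDp W 2) := by
  unfold Summit.BirchSwinnertonDyer.BirchSwinnertonDyer.Theses.PrintCf2.InertJZeroOfFacts
  constructor
  · intro h
    exact ⟨fun hB W _ _ hr hj _ => h hB W hr hj, fun hB W _ _ hr hj _ => h hB W hr hj⟩
  · rintro ⟨hG, hBd⟩ hB W _ _ hr hj
    by_cases hg : Good W 2
    · exact hG hB W hr hj hg
    · exact hBd hB W hr hj hg

/-- **The BAD stub of crux 20671 IS its residual off BOTH Shu–Zhai classes** (granted ARS06 `hARS`, the `36a1`
Table row `htab36` and the `144a1` base fact `hbase144`; the other facts come from `𝔅_inert` itself):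
`stub_inertJZero_badAtTwo ⟺ (𝔅_inert → ∀ W, r_an = 1 → j = 0 → ¬ Good W 2 → ¬ SZ36 W → ¬ SZ144 W → BSDp W 2)`.
[cite: ShuZhai2021, Thm. 1.2, Thm. 1.4 and §5.2 Table row 36a1] [cite: Cremona1997, Table 1 (N = 144, A1) and Table 4 (144 A)]
[cite: AgasheRibetStein2006, Thm. 2.6] -/
theorem stub_inertJZero_badAtTwo_iff_offShuZhai_of_facts
    (hARS : AgasheRibetStein2006.cremona_abs_maninConstant_eq_one_of_level_le) (htab36 : table52_row36a1)
    (hbase144 : base144a1_optimal_cuspZero) :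
    ((rank_eq_analyticRank_of_analyticRank_le_one ∧ hasEntireLFunction_rat ∧
        bsdRHS_eq_of_isIsogenous ∧ bsdTriple_of_hasCM_of_L_one_ne_zero ∧ thm112_bsdTwo_twist ∧
        thm12_ranks_of_twists ∧ thm14_twoPartBSD_of_twists ∧ thm410_twoAdicValuations_of_twists) →
        ∀ (W : WeierstrassCurve ℚ) [W.IsElliptic] [W.IsGloballyMinimal], W.analyticRank = 1 → W.j = 0 →
          ¬ Good W 2 → BSDp W 2) ↔
      ((rank_eq_analyticRank_of_analyticRank_le_one ∧ hasEntireLFunction_rat ∧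
        bsdRHS_eq_of_isIsogenous ∧ bsdTriple_of_hasCM_of_L_one_ne_zero ∧ thm112_bsdTwo_twist ∧
        thm12_ranks_of_twists ∧ thm14_twoPartBSD_of_twists ∧ thm410_twoAdicValuations_of_twists) →
        ∀ (W : WeierstrassCurve ℚ) [W.IsElliptic] [W.IsGloballyMinimal], W.analyticRank = 1 → W.j = 0 →
          ¬ Good W 2 → ¬ Rank1Residual.P2.IsIsogenousToShuZhaiThirtySixTwist W →
            ¬ Rank1Residual.P2.IsIsogenousToShuZhaiOneFortyFourTwist W → BSDp W 2) := by
  constructor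
  · exact fun h hB W _ _ hr hj hng _ _ => h hB W hr hj hng
  · intro h hB W _ _ hr hj hng
    obtain ⟨_, hmod, hCas, hCM, _, h12, h14, _⟩ := hB
    by_cases h1 : Rank1Residual.P2.IsIsogenousToShuZhaiThirtySixTwist W
    · exact (Rank1Residual.P2.analyticRank_eq_one_and_bsdp_two_of_isIsogenousToShuZhaiThirtySixTwist hCas h12
        h14 hCM hmod hARS htab36 W h1).2
    by_cases h2 : Rank1Residual.P2.IsIsogenousToShuZhaiOneFortyFourTwist W
    · exact (Rank1Residual.P2.analyticRank_eq_one_and_bsdp_two_of_isIsogenous_twist_curve144a1_byName hCas h12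
        h14 hCM hmod hARS hbase144 W h2).2
    exact h ⟨‹_›, hmod, hCas, hCM, ‹_›, h12, h14, ‹_›⟩ W hr hj hng h1 h2

/-- **The GOOD stub of crux 20671 IS its residual off the Kriz–Li `243a1` classes** (granted Kriz–Li Thm 4.3
`h33`, the Table-1 row `htab243` and Creutz–Miller S31 `hS31`; the rest from `𝔅_inert`):
`stub_inertJZero_goodAtTwo ⟺ (𝔅_inert → ∀ W, r_an = 1 → j = 0 → Good W 2 → ¬ KL243 W → BSDp W 2)`.
[cite: KrizLi2019, Thm. 5.1 (2), Thm. 4.3 and §6 Table 1 row 243a1] [cite: CreutzMiller2012, Thm. 1.1] -/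
theorem stub_inertJZero_goodAtTwo_iff_offKrizLi_of_facts (h33 : thm33_rank_twist) (htab243 : table1_row243a1)
    (hS31 : bsdTriple_of_analyticRank_le_one_of_conductor_lt) :
    ((rank_eq_analyticRank_of_analyticRank_le_one ∧ hasEntireLFunction_rat ∧
        bsdRHS_eq_of_isIsogenous ∧ bsdTriple_of_hasCM_of_L_one_ne_zero ∧ thm112_bsdTwo_twist ∧
        thm12_ranks_of_twists ∧ thm14_twoPartBSD_of_twists ∧ thm410_twoAdicValuations_of_twists) →
        ∀ (W : WeierstrassCurve ℚ) [W.IsElliptic] [W.IsGloballyMinimal], W.analyticRank = 1 → W.j = 0 →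
          Good W 2 → BSDp W 2) ↔
      ((rank_eq_analyticRank_of_analyticRank_le_one ∧ hasEntireLFunction_rat ∧
        bsdRHS_eq_of_isIsogenous ∧ bsdTriple_of_hasCM_of_L_one_ne_zero ∧ thm112_bsdTwo_twist ∧
        thm12_ranks_of_twists ∧ thm14_twoPartBSD_of_twists ∧ thm410_twoAdicValuations_of_twists) →
        ∀ (W : WeierstrassCurve ℚ) [W.IsElliptic] [W.IsGloballyMinimal], W.analyticRank = 1 → W.j = 0 →
          Good W 2 → ¬ Rank1Residual.P2.IsIsogenousToKrizLiTwoFortyThreeTwist W → BSDp W 2) := by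
  constructor
  · exact fun h hB W _ _ hr hj hg _ => h hB W hr hj hg
  · intro h hB W _ _ hr hj hg
    obtain ⟨hGZK, hmod, hCas, hCM, hKL, _, _, _⟩ := hB
    by_cases h1 : Rank1Residual.P2.IsIsogenousToKrizLiTwoFortyThreeTwist W
    · exact Rank1Residual.P2.bsdp_two_of_isIsogenousToKrizLiTwoFortyThreeTwist hKL h33 htab243 hS31 hCM hmod hGZK
        hCas W h1
    exact h ⟨hGZK, hmod, hCas, hCM, hKL, ‹_›, ‹_›, ‹_›⟩ W hr hj hg h1

/-- **The twist of `36a1` as a sextic**: `⟨1, D, 0, 0⟩ • 36a1^{(D)} = (y² = x³ + D³)` on the nose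
(`36a1^{(D)} : y² = x³ − 3D x² + 3D² x = (x − D)³ + D³`). [cite: SilvermanAEC2009, X.5 Prop. 5.4 (iii)] -/
theorem smul_quadraticTwist_curve36a1_eq_sextic (D : ℚ) :
    (⟨1, D, 0, 0⟩ : WeierstrassCurve.VariableChange ℚ) • Rank1Residual.P2.curve36a1.quadraticTwist D =
      (⟨0, 0, 0, 0, D ^ 3⟩ : WeierstrassCurve ℚ) := by
  ext <;> simp only [WeierstrassCurve.quadraticTwist, Rank1Residual.P2.curve36a1, WeierstrassCurve.b₂,
    WeierstrassCurve.b₄, WeierstrassCurve.b₆, WeierstrassCurve.variableChange_a₁,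
    WeierstrassCurve.variableChange_a₂, WeierstrassCurve.variableChange_a₃, WeierstrassCurve.variableChange_a₄,
    WeierstrassCurve.variableChange_a₆, inv_one, Units.val_one] <;> ring

/-- **BAD reduction at `2` along the Shu–Zhai `36a1` isogeny classes** (p3's family `y² = x³ − (p∏q)³`; p3's
`placement_of_isShuZhaiThirtySixTwist` is the MODEL-level statement): the sextic parameter `−(p∏q)³` is ODD, so a
globally minimal model is bad at `2` (ty2's `Atlas.good_two_iff_of_smul_sextic`), and good reduction is an
isogeny invariant (`IsIsogenous.hasGoodReductionAtPrime_iff`). [cite: SilvermanAEC2009, VII.5 Prop. 5.1 and Cor. VII.7.2] -/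
theorem not_good_two_of_isIsogenousToShuZhaiThirtySixTwist (W : WeierstrassCurve ℚ) [W.IsElliptic]
    (hW : Rank1Residual.P2.IsIsogenousToShuZhaiThirtySixTwist W) : ¬ Good W 2 := by
  obtain ⟨p, Q, hp, h24, hQ, -, hiso⟩ := hW
  set m : ℕ := p * ∏ q ∈ Q, q with hm
  have hprod : Odd (∏ q ∈ Q, q) :=
    Finset.prod_induction _ (fun n => Odd n) (fun a b ha hb => ha.mul hb) odd_one
      (fun q hq => (hQ q hq).1.odd_of_ne_two (by have := (hQ q hq).2; omega))
  have hmodd : Odd (m : ℤ) := by exact_mod_cast (hp.odd_of_ne_two (by omega)).mul hprod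
  have hm0 : (m : ℤ) ≠ 0 := fun h0 => by rw [h0] at hmodd; exact (by decide : ¬ Odd (0 : ℤ)) hmodd
  have hB : -(m : ℤ) ^ 3 ≠ 0 := neg_ne_zero.mpr (pow_ne_zero 3 hm0)
  have hB2 : (m : ℤ) ^ 3 % 2 = 1 := Int.odd_iff.mp hmodd.pow
  have h64 : ¬ (64 : ℤ) ∣ -(m : ℤ) ^ 3 := by omega
  have h16 : ¬ (-(m : ℤ) ^ 3 % 64 = 16) := by omega
  have hd0 : (-(m : ℚ)) ≠ 0 := neg_ne_zero.mpr (by exact_mod_cast hm0)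
  haveI := Rank1Residual.P2.curve36a1.isElliptic_quadraticTwist hd0
  obtain ⟨WpM, _, _, C, hC⟩ := Rank1Residual.P2.exists_globallyMinimal_twist Rank1Residual.P2.curve36a1 hd0
  have hV := smul_quadraticTwist_curve36a1_eq_sextic (-(m : ℚ))
  have hS : (-(m : ℚ)) ^ 3 = (((-(m : ℤ) ^ 3 : ℤ)) : ℚ) := by push_cast; ring
  rw [hS] at hV
  have hT : Rank1Residual.P2.curve36a1.quadraticTwist (-(m : ℚ)) =
      (⟨1, -(m : ℚ), 0, 0⟩ : WeierstrassCurve.VariableChange ℚ)⁻¹ •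
        (⟨0, 0, 0, 0, (((-(m : ℤ) ^ 3 : ℤ)) : ℚ)⟩ : WeierstrassCurve ℚ) :=
    (inv_smul_eq_iff.mpr hV.symm).symm
  have hC' : (C * (⟨1, -(m : ℚ), 0, 0⟩ : WeierstrassCurve.VariableChange ℚ)⁻¹) •
      (⟨0, 0, 0, 0, (((-(m : ℤ) ^ 3 : ℤ)) : ℚ)⟩ : WeierstrassCurve ℚ) = WpM := by
    rw [mul_smul, ← hT, hC]
  have hbad : ¬ Good WpM 2 := fun hg =>
    h16 ((Rank1Residual.P2.CornerFTwo.Atlas.good_two_iff_of_smul_sextic hB h64 hC').mp hg)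
  have hiso' : WeierstrassCurve.IsIsogenous W WpM :=
    hiso.trans' (by rw [← hC]; exact WeierstrassCurve.isIsogenous_smul _ C)
  exact fun hg => hbad ((hiso'.hasGoodReductionAtPrime_iff 2).mp hg)

/-- **The doors do not cross cells**: a Kriz–Li `243a1` class never meets the BAD cell (every member is GOOD at `2`,
p3's `good_two_of_isIsogenousToKrizLiTwoFortyThreeTwist`) and a Shu–Zhai `36a1` / `144a1` class never meets the
GOOD cell (placement: BAD at `2`) — so the two cell residuals together ARE the `j = 0` part of the OFF³ residual
`WAllCornerFTwoInertOffShuZhaiOffKrizLiOffShuZhaiOneFortyFour` relative to `𝔅_inert` (EXACT, unconditional).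
[cite: SilvermanAEC2009, Cor. VII.7.2] -/
theorem offPrint_cells_iff_off3_jZero :
    (((rank_eq_analyticRank_of_analyticRank_le_one ∧ hasEntireLFunction_rat ∧
        bsdRHS_eq_of_isIsogenous ∧ bsdTriple_of_hasCM_of_L_one_ne_zero ∧ thm112_bsdTwo_twist ∧
        thm12_ranks_of_twists ∧ thm14_twoPartBSD_of_twists ∧ thm410_twoAdicValuations_of_twists) →
        ∀ (W : WeierstrassCurve ℚ) [W.IsElliptic] [W.IsGloballyMinimal], W.analyticRank = 1 → W.j = 0 →
          Good W 2 → ¬ Rank1Residual.P2.IsIsogenousToKrizLiTwoFortyThreeTwist W → BSDp W 2) ∧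
      ((rank_eq_analyticRank_of_analyticRank_le_one ∧ hasEntireLFunction_rat ∧
        bsdRHS_eq_of_isIsogenous ∧ bsdTriple_of_hasCM_of_L_one_ne_zero ∧ thm112_bsdTwo_twist ∧
        thm12_ranks_of_twists ∧ thm14_twoPartBSD_of_twists ∧ thm410_twoAdicValuations_of_twists) →
        ∀ (W : WeierstrassCurve ℚ) [W.IsElliptic] [W.IsGloballyMinimal], W.analyticRank = 1 → W.j = 0 →
          ¬ Good W 2 → ¬ Rank1Residual.P2.IsIsogenousToShuZhaiThirtySixTwist W →
            ¬ Rank1Residual.P2.IsIsogenousToShuZhaiOneFortyFourTwist W → BSDp W 2)) ↔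
      ((rank_eq_analyticRank_of_analyticRank_le_one ∧ hasEntireLFunction_rat ∧
        bsdRHS_eq_of_isIsogenous ∧ bsdTriple_of_hasCM_of_L_one_ne_zero ∧ thm112_bsdTwo_twist ∧
        thm12_ranks_of_twists ∧ thm14_twoPartBSD_of_twists ∧ thm410_twoAdicValuations_of_twists) →
        ∀ (W : WeierstrassCurve ℚ) [W.IsElliptic] [W.IsGloballyMinimal], W.analyticRank = 1 → W.j = 0 →
          ¬ Rank1Residual.P2.IsIsogenousToShuZhaiThirtySixTwist W →
            ¬ Rank1Residual.P2.IsIsogenousToKrizLiTwoFortyThreeTwist W →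
              ¬ Rank1Residual.P2.IsIsogenousToShuZhaiOneFortyFourTwist W → BSDp W 2) := by
  constructor
  · rintro ⟨hG, hBd⟩ hB W _ _ hr hj h1 h2 h3
    by_cases hg : Good W 2
    · exact hG hB W hr hj hg h2
    · exact hBd hB W hr hj hg h1 h3
  · intro h
    refine ⟨fun hB W _ _ hr hj hg h2 => h hB W hr hj ?_ h2 ?_, fun hB W _ _ hr hj hng h1 h3 => h hB W hr hj h1 ?_ h3⟩
    · -- a Shu–Zhai `36a1` class is bad at `2`
      exact fun h1 => not_good_two_of_isIsogenousToShuZhaiThirtySixTwist W h1 hg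
    · -- a Shu–Zhai `144a1` class is bad at `2`
      exact fun h3 => (Rank1Residual.P2.placement_of_isIsogenousToShuZhaiOneFortyFourTwist W h3).2.2 hg
    · -- a Kriz–Li `243a1` class is good at `2`
      exact fun h2 => hng (Rank1Residual.P2.good_two_of_isIsogenousToKrizLiTwoFortyThreeTwist W h2)

/-- **THE NAMED RESIDUAL OF CRUX 20671 IN THE KERNEL, EXACT.** Granted ARS06, the `36a1` Table row, the `144a1`
base fact, Kriz–Li Thm 4.3, the Table-1 row `243a1` and Creutz–Miller S31 (every one a cite-tagged statement-only
fact of the tree), route item `InertJZeroOfFacts` holds IFF its two print-free cell residuals hold: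
(GOOD at `2`, off the Kriz–Li `243a1` classes) ∧ (BAD at `2`, off both Shu–Zhai classes) — equivalently iff the
`j = 0` part of `WAllCornerFTwoInertOffShuZhaiOffKrizLiOffShuZhaiOneFortyFour` holds relative to `𝔅_inert`
(`offPrint_cells_iff_off3_jZero`). Nothing in print inside either residual (DOSSIER §15–§17).
[cite: ShuZhai2021, Thm. 1.2, Thm. 1.4 and §5.2 Table row 36a1] [cite: KrizLi2019, Thm. 5.1 (2), Thm. 4.3 and §6 Table 1 row 243a1]
[cite: Cremona1997, Table 1 (N = 144, A1) and Table 4 (144 A)] [cite: AgasheRibetStein2006, Thm. 2.6] [cite: CreutzMiller2012, Thm. 1.1] -/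
theorem inertJZeroOfFacts_iff_cellResiduals_of_facts
    (hARS : AgasheRibetStein2006.cremona_abs_maninConstant_eq_one_of_level_le) (htab36 : table52_row36a1)
    (hbase144 : base144a1_optimal_cuspZero) (h33 : thm33_rank_twist) (htab243 : table1_row243a1)
    (hS31 : bsdTriple_of_analyticRank_le_one_of_conductor_lt) :
    Summit.BirchSwinnertonDyer.BirchSwinnertonDyer.Theses.PrintCf2.InertJZeroOfFacts ↔
      ((rank_eq_analyticRank_of_analyticRank_le_one ∧ hasEntireLFunction_rat ∧
        bsdRHS_eq_of_isIsogenous ∧ bsdTriple_of_hasCM_of_L_one_ne_zero ∧ thm112_bsdTwo_twist ∧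
        thm12_ranks_of_twists ∧ thm14_twoPartBSD_of_twists ∧ thm410_twoAdicValuations_of_twists) →
        ∀ (W : WeierstrassCurve ℚ) [W.IsElliptic] [W.IsGloballyMinimal], W.analyticRank = 1 → W.j = 0 →
          Good W 2 → ¬ Rank1Residual.P2.IsIsogenousToKrizLiTwoFortyThreeTwist W → BSDp W 2) ∧
      ((rank_eq_analyticRank_of_analyticRank_le_one ∧ hasEntireLFunction_rat ∧
        bsdRHS_eq_of_isIsogenous ∧ bsdTriple_of_hasCM_of_L_one_ne_zero ∧ thm112_bsdTwo_twist ∧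
        thm12_ranks_of_twists ∧ thm14_twoPartBSD_of_twists ∧ thm410_twoAdicValuations_of_twists) →
        ∀ (W : WeierstrassCurve ℚ) [W.IsElliptic] [W.IsGloballyMinimal], W.analyticRank = 1 → W.j = 0 →
          ¬ Good W 2 → ¬ Rank1Residual.P2.IsIsogenousToShuZhaiThirtySixTwist W →
            ¬ Rank1Residual.P2.IsIsogenousToShuZhaiOneFortyFourTwist W → BSDp W 2) := by
  rw [inertJZeroOfFacts_iff_stubs, stub_inertJZero_goodAtTwo_iff_offKrizLi_of_facts h33 htab243 hS31,
    stub_inertJZero_badAtTwo_iff_offShuZhai_of_facts hARS htab36 hbase144]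

/-- **THE NAMED RESIDUAL OF CRUX 20671, SHARPENED BY THE FINITE PRINTED SLICE `N < 5000`** (Creutz–Miller S31 =
aside 20770, `P2.bsdp_two_of_analyticRank_le_one_of_conductor_lt_5000`): granted the same six facts, route item
`InertJZeroOfFacts` holds IFF `BSD(W,2)` holds for every globally minimal `W` with `ord_{s=1} L = 1`, `j = 0`,
CONDUCTOR `≥ 5000`, that is (GOOD at `2` and off the Kriz–Li `243a1` classes) or (BAD at `2` and off both Shu–Zhai
classes). This is everything print gives on the `j = 0` class (DOSSIER §14–§17: SZ door exhausted at 36a1/144a1,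
KL door printed at 243a1 only, Creutz–Miller below 5000). [cite: CreutzMiller2012, Thm. 1.1]
[cite: ShuZhai2021, Thm. 1.2, Thm. 1.4 and §5.2 Table row 36a1] [cite: KrizLi2019, Thm. 5.1 (2), Thm. 4.3 and §6 Table 1 row 243a1]
[cite: Cremona1997, Table 1 (N = 144, A1) and Table 4 (144 A)] [cite: AgasheRibetStein2006, Thm. 2.6] -/
theorem inertJZeroOfFacts_iff_cellResiduals_largeConductor_of_facts
    (hARS : AgasheRibetStein2006.cremona_abs_maninConstant_eq_one_of_level_le) (htab36 : table52_row36a1)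
    (hbase144 : base144a1_optimal_cuspZero) (h33 : thm33_rank_twist) (htab243 : table1_row243a1)
    (hS31 : bsdTriple_of_analyticRank_le_one_of_conductor_lt) :
    Summit.BirchSwinnertonDyer.BirchSwinnertonDyer.Theses.PrintCf2.InertJZeroOfFacts ↔
      ((rank_eq_analyticRank_of_analyticRank_le_one ∧ hasEntireLFunction_rat ∧
        bsdRHS_eq_of_isIsogenous ∧ bsdTriple_of_hasCM_of_L_one_ne_zero ∧ thm112_bsdTwo_twist ∧
        thm12_ranks_of_twists ∧ thm14_twoPartBSD_of_twists ∧ thm410_twoAdicValuations_of_twists) →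
        ∀ (W : WeierstrassCurve ℚ) [W.IsElliptic] [W.IsGloballyMinimal], W.analyticRank = 1 → W.j = 0 →
          5000 ≤ W.conductorNorm ℤ → Good W 2 → ¬ Rank1Residual.P2.IsIsogenousToKrizLiTwoFortyThreeTwist W →
            BSDp W 2) ∧
      ((rank_eq_analyticRank_of_analyticRank_le_one ∧ hasEntireLFunction_rat ∧
        bsdRHS_eq_of_isIsogenous ∧ bsdTriple_of_hasCM_of_L_one_ne_zero ∧ thm112_bsdTwo_twist ∧
        thm12_ranks_of_twists ∧ thm14_twoPartBSD_of_twists ∧ thm410_twoAdicValuations_of_twists) →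
        ∀ (W : WeierstrassCurve ℚ) [W.IsElliptic] [W.IsGloballyMinimal], W.analyticRank = 1 → W.j = 0 →
          5000 ≤ W.conductorNorm ℤ → ¬ Good W 2 → ¬ Rank1Residual.P2.IsIsogenousToShuZhaiThirtySixTwist W →
            ¬ Rank1Residual.P2.IsIsogenousToShuZhaiOneFortyFourTwist W → BSDp W 2) := by
  rw [inertJZeroOfFacts_iff_cellResiduals_of_facts hARS htab36 hbase144 h33 htab243 hS31]
  have small : ∀ (W : WeierstrassCurve ℚ) [W.IsElliptic] [W.IsGloballyMinimal], W.analyticRank = 1 →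
      W.conductorNorm ℤ < 5000 → BSDp W 2 :=
    fun W _ _ hr hN => Rank1Residual.P2.bsdp_two_of_analyticRank_le_one_of_conductor_lt_5000 hS31 W hr.le hN
  constructor
  · rintro ⟨hG, hBd⟩
    exact ⟨fun hB W _ _ hr hj _ hg h2 => hG hB W hr hj hg h2,
      fun hB W _ _ hr hj _ hng h1 h3 => hBd hB W hr hj hng h1 h3⟩
  · rintro ⟨hG, hBd⟩
    refine ⟨fun hB W _ _ hr hj hg h2 => ?_, fun hB W _ _ hr hj hng h1 h3 => ?_⟩
    · by_cases hN : W.conductorNorm ℤ < 5000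
      · exact small W hr hN
      · exact hG hB W hr hj (not_lt.mp hN) hg h2
    · by_cases hN : W.conductorNorm ℤ < 5000
      · exact small W hr hN
      · exact hBd hB W hr hj (not_lt.mp hN) hng h1 h3

end Summit.BirchSwinnertonDyer.PrintCf2
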